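import Summits.QuantumFields.YangMills.Theorems.BalabanUVNodesN14SourceTowerOfRecordSpine

/-!
# DAG node N14 · NE1′ — THE GUARD OF RECORD DOES NOT IMPLY N14's RATE CONJUNCT; THE PIN DOES (located, decided): the doubling tower passes
# dag-n14-w2's `Nondegenerate` and fails `N14At`, so the K3⁷ v3 guard road leaves `N14At (rrOfRecord 𝔯 ksel …).ne1` to the stub-1 prover, while the pin
# `Ne1PinnedOfRecord` (FILE 3) gives it by name and implies the guard

Cell `pub-ymgap`, YM-PLAN Track A (HUMAN RULING D-0062 ∕ D-0149, director-ym №197), width seat `pub-ymgap-dag-n14-w1` (generation 2), FILE 6 of the seat.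
THEOREMS ONLY (0 `def`); imports FILE 4 `BalabanUVNodesN14SourceTowerOfRecordSpine` (p594469) ONLY (it brings FILE 3, FILE 2 p586623, dag-n14-w2's guard p584216 and
dag-n14-c's `…N14AtRateRecord13CoPHOn`); modifies nothing; `--supports` K3⁷ `SpineGivenEndpointR13SepCoPH` (stmt-QuantumFields-20544) `--as helper` — COUNT-NEUTRAL.

WHY (located, for plan g82's K3⁷ v4 choice on the N14 slot: v3 OF RECORD 02f6f498332fdbee conjoins the GUARD `Ne1NondegenerateOn 𝔯 (unityNondeg₁₃H 2)`; this seat's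
K3V4-N14-DRAFT fa70673c442bca57 displays the PIN `Ne1PinnedOfRecord 𝔯` instead).  The two roads are NOT equivalent: dag-n14-a's DOUBLING tower `⟨Unit, growingTower, 1⟩`
(FILE 1 §4's located refuter; sizes `2^k`) PASSES the guard of record (index `Unit` inhabited, its one birth, positive sizes) and FAILS `N14At` (`YMDAG.N14.not_n14At_growing_one`).
Hence `Nondegenerate ↛ N14At` on carriers, and — given ONE admissible Stage-13 tuple in the regime — `Ne1NondegenerateOn 𝔯 Rg ↛ S_N14 (RRec₁₃CoPHOn 𝔯 Rg)` on readings: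
under v3's text the stub-1 prover still OWES the rate conjunct `N14At (rrOfRecord 𝔯 ksel …).ne1` for its witness; under the pin it is FILE 3's
`n14At_rateCarriersOfRecord₁₃CoPH_of_pinned` and the guard follows (`guard_and_s_N14_of_ne1PinnedOfRecord`).  The growing reading is the separating witness (guard ✓,
pin ✗ — FILE 4 `not_ne1PinnedOfRecord_growing`).  On the other side dag-n14-w2's `nondegenerate_toyTower` with dag-n14-a's `n14At_toyTower` shows guard ∧ rate conjunct
JOINTLY satisfiable by a datum-blind toy — why neither road is a discharge (dag-lead's rule; the chair's acts (i)–(v)).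

* §1 [decided] `birthsNonempty_growingTower` · `notVacuum_growingTower` · ★ `nondegenerate_growing` · ★★ `guard_not_imp_n14At`.
* §2 [reading level] `ne1NondegenerateOn_growing` · ★★ `guard_not_imp_s_N14` · ★ `guard_and_not_pinned_growing` · `pin_imp_guard_and_s_N14` (FILE 3, displayed side by side).
* §3 [toy side] `nondegenerate_and_n14At_toy`.

HONEST FRAMING.  Decided facts about two toy towers plus by-name bookkeeping; prices the guard road against the pin road for the skeleton's N14 slot; nothing in v3 is
claimed wrong; nothing of Bałaban's is asserted; N14 NOT discharged; NE1′ for sub-unit observables NOT PRINTED ∕ NOT PROVED; K3⁷ OPEN, not claimed; counts unmoved (typed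
28∕28 · discharged 5∕27, A 5∕28).  The Yang–Mills mass gap (Clay) is NOT proved by any of this — R4 closes the conditional finite-𝕋⁴ rung `BalabanLadder.UV` only; NOT ℝ⁴,
NOT OS, NOT a mass gap.
-/

noncomputable section

namespace YMDAG.N14.TopBorn

open Literature.MathematicalPhysics.QuantumFieldTheory.Balaban1983to89
open Literature.MathematicalPhysics.QuantumFieldTheory.Balaban1983to89.T4Continuum
open Summit.QuantumFields.BalabanUV.T4Continuum.NE1p.DressedRoot
open YMDAG.UVSplit
open YMDAG.N14.TowerGuard (BirthsNonempty NotVacuum Nondegenerate Ne1NondegenerateOn nondegenerate_toyTower)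
open Node00 (Stage13HParams RateObjects₁₁)

/-! ## §1 The doubling tower passes the guard of record and fails `N14At` -/

section Carriers

/-- Every booking of the doubling tower has its one birth. [folklore] -/
theorem birthsNonempty_growingTower : BirthsNonempty growingTower := fun _ _ => ⟨(() : Unit)⟩

/-- The doubling tower is not the vacuum: at cutoff `0` its birth books size `2^0 = 1 > 0`. [folklore] -/
theorem notVacuum_growingTower : NotVacuum growingTower :=
  ⟨(), 0, (), 0, le_rfl, le_rfl, by show (0 : ℝ) < (2 : ℝ) ^ 0; norm_num⟩

/-- **THE DOUBLING TOWER PASSES dag-n14-w2's GUARD OF RECORD** at every rate `Λ` [decided]. [folklore] -/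
theorem nondegenerate_growing (Λ : ℝ) : Nondegenerate ⟨Unit, growingTower, Λ⟩ :=
  ⟨⟨()⟩, birthsNonempty_growingTower, notVacuum_growingTower⟩

/-- **THE GUARD DOES NOT IMPLY N14's RATE CONJUNCT** [decided]: `Nondegenerate ↛ N14At` on `NE1pCarriers` — the doubling tower at rate `1` (dag-n14-a's
`not_n14At_growing_one`). [folklore] -/
theorem guard_not_imp_n14At : ¬ ∀ c : NE1pCarriers, Nondegenerate c → N14At c :=
  fun h => not_n14At_growing_one (h ⟨Unit, growingTower, 1⟩ (nondegenerate_growing 1))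

end Carriers

/-! ## §2 Reading level: the guard road vs the pin road for the skeleton's N14 slot -/

section Readings

variable {N : ℕ} [NeZero N]
  (lit : (F : T4Family) → (θ : Stage13HParams F N) → θ.Provisos₁₃CoPH F N → (ℕ → ℝ) → List (ULoop F) → RateObjects₁₁ N)
  (Rg : (F : T4Family) → Stage13HParams F N → Prop)

/-- The GROWING READING (any `lit`, `ne1 :=` the doubling tower at rate `1` everywhere) passes the keyed guard of record at EVERY regime. [folklore] -/
theorem ne1NondegenerateOn_growing :
    Ne1NondegenerateOn (⟨lit, fun _ _ _ _ _ => ⟨Unit, growingTower, 1⟩⟩ : RateReading₁₃CoPH N) Rg :=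
  fun _ _ _ _ _ _ _ => nondegenerate_growing 1

include lit in
/-- **THE GUARD ROAD LEAVES N14's RATE CONJUNCT OPEN** [decided, given ONE admissible Stage-13 tuple with provisos in the regime]: `Ne1NondegenerateOn 𝔯 Rg` does NOT
imply `S_N14 (RRec₁₃CoPHOn 𝔯 Rg)` for every reading — the growing reading passes the guard and has no `S_N14` (dag-n14-c's `not_s_N14_rRec₁₃CoPHOn_of_hits_growing`).
Under K3⁷ v3's text the stub-1 prover therefore still owes `N14At` at its witness. [folklore] -/
theorem guard_not_imp_s_N14 (hinh : ∃ (F : T4Family) (θ : Stage13HParams F N) (_ : θ.Provisos₁₃CoPH F N), Rg F θ ∧ θ.Admissible F N) :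
    ¬ ∀ 𝔯 : RateReading₁₃CoPH N, Ne1NondegenerateOn 𝔯 Rg → S_N14 (RRec₁₃CoPHOn 𝔯 Rg) := by
  intro h
  obtain ⟨F, θ, hP, hRg, hθ⟩ := hinh
  exact not_s_N14_rRec₁₃CoPHOn_of_hits_growing ⟨lit, fun _ _ _ _ _ => ⟨Unit, growingTower, 1⟩⟩ Rg θ hP hRg hθ (fun _ => 0) [] rfl
    (h _ (ne1NondegenerateOn_growing lit Rg))

/-- **THE SEPARATING WITNESS** [decided, given one Stage-13 tuple with provisos]: the growing reading passes the guard of record at every regime and is NOT pinned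
(FILE 4 `not_ne1PinnedOfRecord_growing`) — the pin is STRICTLY stronger than the guard. [folklore] -/
theorem guard_and_not_pinned_growing {F : T4Family} (θ : Stage13HParams F N) (hP : θ.Provisos₁₃CoPH F N) :
    Ne1NondegenerateOn (⟨lit, fun _ _ _ _ _ => ⟨Unit, growingTower, 1⟩⟩ : RateReading₁₃CoPH N) Rg ∧
      ¬ Ne1PinnedOfRecord (⟨lit, fun _ _ _ _ _ => ⟨Unit, growingTower, 1⟩⟩ : RateReading₁₃CoPH N) :=
  ⟨ne1NondegenerateOn_growing lit Rg, not_ne1PinnedOfRecord_growing lit θ hP⟩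

/-- **THE PIN ROAD GIVES BOTH** (FILE 3 `guard_and_s_N14_of_ne1PinnedOfRecord`, displayed side by side): under `Ne1PinnedOfRecord 𝔯` the keyed guard of record AND
`S_N14` hold at every regime — nothing is left to the stub-1 prover on the N14 slot. [folklore] -/
theorem pin_imp_guard_and_s_N14 (𝔯 : RateReading₁₃CoPH N) (h : Ne1PinnedOfRecord 𝔯) :
    Ne1NondegenerateOn 𝔯 Rg ∧ S_N14 (RRec₁₃CoPHOn 𝔯 Rg) :=
  guard_and_s_N14_of_ne1PinnedOfRecord 𝔯 Rg h

end Readings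

/-! ## §3 The toy side: guard ∧ rate conjunct are jointly satisfiable by a datum-blind toy (why neither road is a discharge) -/

/-- dag-n14-w2's `nondegenerate_toyTower` with dag-n14-a's `n14At_toyTower`: the CONSTANT toy carriers `⟨Unit, toyTower, 2⟩` pass the guard AND satisfy `N14At` —
a datum-blind inhabitant of «guard ∧ rate conjunct»; what a pin adds is the BY-NAME tie to an object that reads the datum (FILE 3 ∕ FILE 5). [folklore] -/
theorem nondegenerate_and_n14At_toy : Nondegenerate ⟨Unit, toyTower, 2⟩ ∧ N14At ⟨Unit, toyTower, 2⟩ :=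
  ⟨nondegenerate_toyTower 2, n14At_toyTower⟩

end YMDAG.N14.TopBorn

end
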